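import Summits.HodgeConjecture.HodgeConjecture.Theorems.GenericDivisibilityGenericDivisibilityBoundedChowZeroBelowTop
import Literature.AlgebraicGeometry.HodgeTheory.CubicFourfoldHodgeConjectureChowZero
import Literature.AlgebraicGeometry.Motives.ChowZeroSupportedOnHyperplaneSectionOfRationalCurves
import HarnessLib

/-!
# Route GenericDivisibility — crux C2 `GenericDivisibilityBounded` (stmt-HodgeConjecture-18467):
# the heart and C2 on varieties covered by rational curves and on low-degree hypersurfaces

Lead c4 (cycle 6). Sorry-free, definition-free. Instances of the sector "`CH₀(X)` supported on a
divisor" of `…GenericDivisibilityBoundedChowZeroBelowTop` (p160943), fed by two PROVED tree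
theorems on `CH₀`:

* `Motives.exists_forall_isRationallyEquivalent_primeCycle_of_rationalCurves_of_isSmoothProjective` —
  through every closed point a rational curve ⇒ every closed point is rationally equivalent to a
  `0`-cycle on one proper closed subset (Voisin II, remark after Prop. 10.26: Conte–Murre's uniruled
  fourfolds), which with `HodgeTheory.chowZeroSupportedInDimLE_of_forall_point` gives
  `HasChowZeroSupportedInDimLE X (n - 1)`;
* `HodgeTheory.hasChowZeroSupportedInDimLE_of_isSmoothHypersurface` — a smooth hypersurface
  `X ⊂ ℙ^{n+1}` of degree `1 ≤ e ≤ n` has `CH₀` supported in dimension `≤ n - 1` (lines through every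
  point).

## Main results

* `genericDivisibilityBounded_hasChowZeroSupportedInDimLE_of_rationalCurves` — the packaging
  "covered by rational curves ⇒ `CH₀` supported on a divisor";
* `genericDivisibilityBounded_levelClean_of_rationalCurves`, `…_at_of_rationalCurves` — **the heart
  at EVERY prime and level, and C2, on every smooth projective `2p`-fold covered by rational curves**
  (uniruled `2p`-folds: `ℙ¹ × Y`, conic bundles, Fano varieties, …; `p ≥ 1`);
* `genericDivisibilityBounded_levelClean_of_isSmoothHypersurface`, `…_at_of_isSmoothHypersurface` —
  **the same on every smooth hypersurface `X ⊂ ℙ^{2p+1}` of degree `1 ≤ e ≤ 2p`** (cubic and quartic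
  fourfolds, …);
* `stub_heartOfCoveredByRationalCurves` — registered sub-goal of the crux item, verbatim.

References: [VoisinHodgeII2003] Prop. 10.26 and the remark following it, Thm. 10.17;
[BlochSrinivas1983] Thm. 1; [ConteMurre1978] (via Voisin's remark).
-/

set_option linter.dupNamespace false

noncomputable section

namespace Summit.HodgeConjecture.HodgeConjecture.Theorems

open CategoryTheory AlgebraicGeometry
open Literature.AlgebraicGeometry.Motives Literature.AlgebraicGeometry.HodgeTheory
  Literature.AlgebraicTopology.SingularHomology
open Literature.Barriers.HodgeConjecture (HasChowZeroSupportedInDimLE)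
open Summit.HodgeConjecture.HodgeConjecture.Theses.GenericDivisibility

/-- Restriction `H^k(X(ℂ);ℤ) → H^k((X∖Z)(ℂ);ℤ)`, the very term of the route decls (notation only). -/
local notation3 (prettyPrint := false) "Res[" X ", " Z ", " k "]" =>
  singularCohomology.map ℤ ℤ
    (⟨Subtype.val, continuous_subtype_val⟩ : C(complexPointsCompl X Z, ComplexPoints X)) k

/-! ### Covered by rational curves ⇒ `CH₀` supported on a divisor -/

/-- **A smooth projective complex `n`-fold through every closed point of which passes a rational
curve has `CH₀` supported on a closed algebraic subset of dimension `≤ n - 1`** (Voisin II, remark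
following Prop. 10.26: "every point `x` is contained in a rational curve `C_x` … `x` is rationally
equivalent in `X` to any point of `X' ∩ C_x`", `X'` an ample hypersurface). A rational curve
through `x` is a non-constant morphism `ν : ℙ¹ ⟶ X` with `x` in its image.
[cite: VoisinHodgeII2003, Prop. 10.26 and the remark following it (§10.2.3)] -/
theorem genericDivisibilityBounded_hasChowZeroSupportedInDimLE_of_rationalCurves {n : ℕ}
    {X : SchemeOver ℂ} (hX : IsSmoothProjective n X)
    (hcov : ∀ x : ↥X.left, Order.height x = 0 → ∃ ν : projectiveSpace 1 ℂ ⟶ X,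
      x ∈ Set.range ν.left.base ∧ ¬ ∀ a b, ν.left.base a = ν.left.base b) :
    HasChowZeroSupportedInDimLE X (n - 1) := by
  obtain ⟨W, hW, hWu, hpt⟩ :=
    exists_forall_isRationallyEquivalent_primeCycle_of_rationalCurves_of_isSmoothProjective hX hcov
  exact ⟨W, chowZeroSupportedInDimLE_of_forall_point hX (by omega) hW hWu hpt⟩

/-- **The heart of line `finite-level-bootstrap` at EVERY prime `ℓ` and level `s` on a smooth
projective `2p`-fold (`p ≥ 1`) covered by rational curves** (uniruled `2p`-folds): `CH₀` is supported
on a divisor, hence `N¹H^{2p} = H^{2p}` (Bloch–Srinivas + Andreotti–Frankel), hence every integral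
middle class is generically torsion (`w = 0`).
[cite: VoisinHodgeII2003, Prop. 10.26 and the remark following it (§10.2.3)]
[cite: BlochSrinivas1983, Thm. 1 and its proof] -/
theorem genericDivisibilityBounded_levelClean_of_rationalCurves {p : ℕ} (hp : 1 ≤ p)
    {X : SchemeOver ℂ} (hX : IsSmoothProjective (2 * p) X)
    (hcov : ∀ x : ↥X.left, Order.height x = 0 → ∃ ν : projectiveSpace 1 ℂ ⟶ X,
      x ∈ Set.range ν.left.base ∧ ¬ ∀ a b, ν.left.base a = ν.left.base b) (ℓ s : ℕ) :
    ∀ z : singularCohomology ℤ ℤ (ComplexPoints X) (2 * p),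
      (∃ Z : Set X.left, IsClosed Z ∧ Z ≠ Set.univ ∧
        ∃ (y : singularCohomology ℤ ℤ (complexPointsCompl X Z) (2 * p)) (M : ℕ), 1 ≤ M ∧
          M • (Res[X, Z, 2 * p] z - ℓ ^ s • y) = 0) →
      ∃ w : singularCohomology ℤ ℤ (ComplexPoints X) (2 * p), ∃ Z : Set X.left, IsClosed Z ∧
        Z ≠ Set.univ ∧ ∃ N : ℕ, 1 ≤ N ∧ N • Res[X, Z, 2 * p] (z - ℓ • w) = 0 :=
  genericDivisibilityBounded_levelClean_of_hasChowZeroSupportedInDimLE hX (k := 2 * p) (by omega)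
    (genericDivisibilityBounded_hasChowZeroSupportedInDimLE_of_rationalCurves hX hcov) ℓ s

/-- **C2 on a smooth projective `2p`-fold (`p ≥ 1`) covered by rational curves.**
[cite: VoisinHodgeII2003, Prop. 10.26 and the remark following it (§10.2.3)]
[cite: BlochSrinivas1983, Thm. 1 and its proof] -/
theorem genericDivisibilityBounded_at_of_rationalCurves {p : ℕ} (hp : 1 ≤ p)
    {X : SchemeOver ℂ} (hX : IsSmoothProjective (2 * p) X)
    (hcov : ∀ x : ↥X.left, Order.height x = 0 → ∃ ν : projectiveSpace 1 ℂ ⟶ X,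
      x ∈ Set.range ν.left.base ∧ ¬ ∀ a b, ν.left.base a = ν.left.base b) :
    ∀ z : singularCohomology ℤ ℤ (ComplexPoints X) (2 * p),
      (∀ m : ℕ, 1 ≤ m → ∃ Z : Set X.left, IsClosed Z ∧ Z ≠ Set.univ ∧
        ∃ y : singularCohomology ℤ ℤ (complexPointsCompl X Z) (2 * p), m • y = Res[X, Z, 2 * p] z) →
      singularCohomology.ringChange (Int.castRingHom ℂ) (ComplexPoints X) (2 * p) z ∈
        supportedClasses X (2 * p) 1 :=
  genericDivisibilityBounded_at_of_hasChowZeroSupportedInDimLE hX (k := 2 * p) (by omega)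
    (genericDivisibilityBounded_hasChowZeroSupportedInDimLE_of_rationalCurves hX hcov)

/-- **Registered sub-goal `stub_heartOfCoveredByRationalCurves` of stmt-HodgeConjecture-18467 (lead
c4): the heart at every `(ℓ, s)` on smooth projective `2p`-folds covered by rational curves**,
verbatim. [cite: VoisinHodgeII2003, Prop. 10.26 and the remark following it (§10.2.3)] -/
theorem stub_heartOfCoveredByRationalCurves : ∀ ⦃p : ℕ⦄ ⦃X : SchemeOver ℂ⦄, 1 ≤ p → IsSmoothProjective (2 * p) X → (∀ x : ↥X.left, Order.height x = 0 → ∃ ν : projectiveSpace 1 ℂ ⟶ X, x ∈ Set.range ν.left.base ∧ ¬ ∀ a b, ν.left.base a = ν.left.base b) → ∀ ℓ s : ℕ, ∀ z : singularCohomology ℤ ℤ (ComplexPoints X) (2 * p), (∃ Z : Set X.left, IsClosed Z ∧ Z ≠ Set.univ ∧ ∃ (y : singularCohomology ℤ ℤ (complexPointsCompl X Z) (2 * p)) (M : ℕ), 1 ≤ M ∧ M • (singularCohomology.map ℤ ℤ (⟨Subtype.val, continuous_subtype_val⟩ : C(complexPointsCompl X Z, ComplexPoints X)) (2 * p) z -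 ℓ ^ s • y) = 0) → ∃ w : singularCohomology ℤ ℤ (ComplexPoints X) (2 * p), ∃ Z : Set X.left, IsClosed Z ∧ Z ≠ Set.univ ∧ ∃ N : ℕ, 1 ≤ N ∧ N • singularCohomology.map ℤ ℤ (⟨Subtype.val, continuous_subtype_val⟩ : C(complexPointsCompl X Z, ComplexPoints X)) (2 * p) (z - ℓ • w) = 0 :=
  fun _ _ hp hX hcov ℓ s ↦ genericDivisibilityBounded_levelClean_of_rationalCurves hp hX hcov ℓ s

/-! ### Smooth hypersurfaces of degree `≤ 2p` in `ℙ^{2p+1}` -/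

/-- **The heart at EVERY prime `ℓ` and level `s` on a smooth hypersurface `X ⊂ ℙ^{2p+1}` of degree
`1 ≤ e ≤ 2p`** (cubic and quartic fourfolds, …): lines through every point put `CH₀` on a hyperplane
section (`hasChowZeroSupportedInDimLE_of_isSmoothHypersurface`), then the divisor sector.
[cite: VoisinHodgeII2003, remark following Prop. 10.26 (§10.2.3)] [cite: BlochSrinivas1983, Thm. 1 and its proof] -/
theorem genericDivisibilityBounded_levelClean_of_isSmoothHypersurface {p e : ℕ} (hp : 1 ≤ p)
    {X : SchemeOver ℂ} (hX : IsSmoothHypersurface (2 * p) e X) (he : 0 < e) (hep : e ≤ 2 * p)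
    (ℓ s : ℕ) :
    ∀ z : singularCohomology ℤ ℤ (ComplexPoints X) (2 * p),
      (∃ Z : Set X.left, IsClosed Z ∧ Z ≠ Set.univ ∧
        ∃ (y : singularCohomology ℤ ℤ (complexPointsCompl X Z) (2 * p)) (M : ℕ), 1 ≤ M ∧
          M • (Res[X, Z, 2 * p] z - ℓ ^ s • y) = 0) →
      ∃ w : singularCohomology ℤ ℤ (ComplexPoints X) (2 * p), ∃ Z : Set X.left, IsClosed Z ∧
        Z ≠ Set.univ ∧ ∃ N : ℕ, 1 ≤ N ∧ N • Res[X, Z, 2 * p] (z - ℓ • w) = 0 :=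
  genericDivisibilityBounded_levelClean_of_hasChowZeroSupportedInDimLE hX.1 (k := 2 * p) (by omega)
    (hasChowZeroSupportedInDimLE_of_isSmoothHypersurface hX he hep) ℓ s

/-- **C2 on a smooth hypersurface `X ⊂ ℙ^{2p+1}` of degree `1 ≤ e ≤ 2p`.**
[cite: VoisinHodgeII2003, remark following Prop. 10.26 (§10.2.3)] [cite: BlochSrinivas1983, Thm. 1 and its proof] -/
theorem genericDivisibilityBounded_at_of_isSmoothHypersurface {p e : ℕ} (hp : 1 ≤ p)
    {X : SchemeOver ℂ} (hX : IsSmoothHypersurface (2 * p) e X) (he : 0 < e) (hep : e ≤ 2 * p) :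
    ∀ z : singularCohomology ℤ ℤ (ComplexPoints X) (2 * p),
      (∀ m : ℕ, 1 ≤ m → ∃ Z : Set X.left, IsClosed Z ∧ Z ≠ Set.univ ∧
        ∃ y : singularCohomology ℤ ℤ (complexPointsCompl X Z) (2 * p), m • y = Res[X, Z, 2 * p] z) →
      singularCohomology.ringChange (Int.castRingHom ℂ) (ComplexPoints X) (2 * p) z ∈
        supportedClasses X (2 * p) 1 :=
  genericDivisibilityBounded_at_of_hasChowZeroSupportedInDimLE hX.1 (k := 2 * p) (by omega)
    (hasChowZeroSupportedInDimLE_of_isSmoothHypersurface hX he hep)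

end Summit.HodgeConjecture.HodgeConjecture.Theorems

end
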